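import Summits.Ventures.HodgeRepro.CongruenceHermitianSubmersion
import Summits.Ventures.HodgeRepro.BallLemmaWLE

/-!
# R5 for `g′ ≤ p` forms with every clause, on the rational points of any Hermitian form (seat p5)

Blind re-derivation cell `pub-hodge-repro`, seat `p5`.  ROUTE-C R5 / ROUTE.md A4 «Iteration (R5)» in the
generality the route uses it: `g′ = dim A′ ≤ p` pulled-back eigenforms on the `p`-ball (`p = max(3k, g)` or
`3g`), not exactly `p`.  Assembly of `BallLemmaWLE` (Lemma W, submersion and dominance for `g ≤ p` forms; per-translate
invariance), `CongruenceHermitianLevel` / `CongruenceHermitianCover` (congruence level and finite index of the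
iterated `Γ″`, any finite family of rational translates) and typer-2's proved real approximation
`dense_ratPointsOf`.

* **`lemmaW_all_congruenceCover_ratPointsOf_le`** — for `Γ(M) ≤ Γ′ ≤ U(H_K)(𝓞_K)`, `M ≠ 0`, transported to
  `U(p,1)`, and `g ≤ p` functions `h_l` analytic near the ball, none locally constant on it, with
  `Γ′`-invariant `dh_l` (the lifts of `g` holomorphic 1-forms on `S_{Γ′}`), there are rational
  `γ_1, …, γ_g ∈ ratPointsOf` such that (i) on an open dense set of points `z` the map `w ↦ (h_l(γ_l w))_{l<g}`
  is a submersion at `z`; (ii) every entire `H : ℂ^g → ℂ` vanishing on `{(h_l(γ_l w))_{l<g} : w ∈ 𝔹^p}` is `0`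
  (the image is Zariski dense — for `A′ = ℂ^g/Λ`, `f(S′)` lies in no theta-divisor: `f` is dominant); (iii) each
  translate `γ_l^*(dh_l)` is invariant under `Γ″ = Γ′ ⊓ ⨅_l γ_l⁻¹ Γ′ γ_l`; (iv) `Γ″ ⊇ toUp(Γ(L))` for some
  `L ≠ 0` (a congruence subgroup); (v) `Γ″` has finite index in `Γ′`.

What stays on paper: 13.2(a) (the eigenforms ARE the `dh_l` of the Albanese coordinates; `T`-equivariance),
13.2(c) (components), and the textbook sentence that a proper closed subvariety of the projective `A′` lies in a
divisor (the zero locus of a theta function — an entire function on `ℂ^g`).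

Nothing here says anything about the status of the Hodge conjecture for CM abelian varieties.
-/

set_option autoImplicit false

noncomputable section

namespace Summit.Ventures.HodgeRepro

namespace CongHerm

open Matrix Filter Topology
open NumberField
open HodgeRepro.BallGen (Idx GLp U Ball unitaryGroupOf ratPointsOf pullback center)
open HodgeRepro.BallGen.RealApprox (dense_ratPointsOf)
open HodgeRepro.BallGen.Inv (IsInvariant)
open HodgeRepro.BallGen.Holo (ballSet actE isOpen_ballSet val_mem_ballSet)
open HodgeRepro.BallGen.Subm (dcov)
open HodgeRepro.BallGen.Dom (eq_zero_of_eqOn_image_of_mem_nhds)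
open HodgeRepro.BallGen.LE (exists_submersion_on_dense_le isInvariant_pullback_inf_iInf)
open CongGen

variable {p : ℕ} {K : Type} [Field K] [NumberField K] [IsCMField K]
variable (HK : Matrix (Idx p) (Idx p) K) (φ₀ : K →+* ℂ) (P : GLp p)
  (hP : (P : Matrix (Idx p) (Idx p) ℂ)ᴴ * HK.map φ₀ * (P : Matrix (Idx p) (Idx p) ℂ) = HodgeRepro.BallGen.J p)

/-- **R5 for `g ≤ p` forms with every clause, on the rational points of an arbitrary Hermitian form of
signature `(p,1)` over a CM field.**  Let `Γ(M) ≤ Γ′ ≤ U(H_K)(𝓞_K)`, `M ≠ 0`, be transported to `U(p,1)` by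
`toUp`, and let `h_1, …, h_g` (`g ≤ p`) be analytic on a neighbourhood of the ball, none locally constant on
it, with `Γ′`-invariant differential covector fields `dh_l`.  Then there are rational
`γ_1, …, γ_g ∈ ratPointsOf` such that: on an open dense set of points `z` of the ball the map
`w ↦ (h_l(γ_l w))_{l<g}` maps every neighbourhood of `z` onto a neighbourhood of its value; every entire
`H : ℂ^g → ℂ` vanishing at every point `(h_l(γ_l w))_{l<g}`, `w ∈ 𝔹^p`, is identically zero; each translate
`γ_l^*(dh_l)` is invariant under `Γ″ = Γ′ ⊓ ⨅_l γ_l⁻¹ Γ′ γ_l`; `Γ″` contains the transported principal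
congruence subgroup `Γ(L)` for some `L ≠ 0`; and `Γ″` has finite index in `Γ′`. -/
theorem lemmaW_all_congruenceCover_ratPointsOf_le {g : ℕ} (hg : g ≤ p)
    {Γ' : Subgroup (unitaryGroupOf HK)} (hΓ : Γ' ≤ arithU HK) {M : 𝓞 K} (hM0 : M ≠ 0)
    (hM : congrU HK M ≤ Γ') {h : Fin g → (Fin p → ℂ) → ℂ}
    (hh : ∀ l, AnalyticOnNhd ℂ (h l) (ballSet p)) (hh0 : ∀ l, ∃ w : Ball p, dcov (h l) w.1 ≠ 0)
    (hhΓ : ∀ l, IsInvariant (Γ'.map (toUp HK φ₀ P hP)) fun w : Ball p => dcov (h l) w.1) :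
    ∃ γ : Fin g → U p, (∀ l, γ l ∈ ratPointsOf φ₀ HK P hP) ∧
      (∃ S : Set (Ball p), IsOpen S ∧ Dense S ∧ ∀ z ∈ S, ∀ U ∈ 𝓝 z.1,
        (fun w l => h l (actE (γ l) w)) '' U ∈ 𝓝 fun l => h l (actE (γ l) z.1)) ∧
      (∀ H : (Fin g → ℂ) → ℂ, AnalyticOnNhd ℂ H Set.univ →
        (∀ w ∈ ballSet p, H (fun l => h l (actE (γ l) w)) = 0) → H = 0) ∧
      (∀ l, IsInvariant (Γ'.map (toUp HK φ₀ P hP) ⊓ ⨅ l, conjSubG (γ l) (Γ'.map (toUp HK φ₀ P hP)))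
        (pullback (γ l) fun w : Ball p => dcov (h l) w.1)) ∧
      (∃ L : 𝓞 K, L ≠ 0 ∧ (congrU HK L).map (toUp HK φ₀ P hP) ≤
        Γ'.map (toUp HK φ₀ P hP) ⊓ ⨅ l, conjSubG (γ l) (Γ'.map (toUp HK φ₀ P hP))) ∧
      (Γ'.map (toUp HK φ₀ P hP) ⊓ ⨅ l, conjSubG (γ l) (Γ'.map (toUp HK φ₀ P hP))).IsFiniteRelIndex
        (Γ'.map (toUp HK φ₀ P hP)) := by
  obtain ⟨γ, hγ, S, hSo, hSd, hsub⟩ :=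
    exists_submersion_on_dense_le hg (dense_ratPointsOf φ₀ HK P hP) hh hh0
  refine ⟨γ, hγ, ⟨S, hSo, hSd, hsub⟩, fun H hH h0 => ?_, fun l => isInvariant_pullback_inf_iInf hhΓ γ l,
    exists_congrU_map_le_inf_iInf_conjSubG_ratPointsOf HK φ₀ P hP hM0 hM γ hγ,
    isFiniteRelIndex_inf_iInf_conjSubG_ratPointsOf HK φ₀ P hP hΓ hM0 hM γ hγ⟩
  haveI : Nonempty (Ball p) := ⟨center p⟩
  obtain ⟨z, hz⟩ := hSd.nonempty
  exact eq_zero_of_eqOn_image_of_mem_nhds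
    (hsub z hz (ballSet p) (isOpen_ballSet.mem_nhds (val_mem_ballSet z))) hH h0

end CongHerm

end Summit.Ventures.HodgeRepro

end
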